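import Literature.MathematicalPhysics.QuantumFieldTheory.Balaban1983to89.T4TwoRunUniqueness
import Summits.QuantumFields.BalabanUV.Beta.EriceRemainderEnclosureHistoryTwoLoop

/-!
# EriceRemainderEnclosureHistoryUniqueness — (E32) ASYMPTOTIC FREEDOM ORDERS THE HISTORY, II: the UNIQUENESS leg of Theorem 2's
# renormalization condition («g₀ = g₀(ε, g)») is paid, along the runs of (0.20), by the ROW TOTAL WEIGHT of the history modulus —
# the junction's currency of (D4-J2) — against the asymptotic-freedom FLOOR that the junction buys; NO decay of the memory in the age

Cell `pub-balaban`, β-function sub-cell, BINDER row D4 «RemainderConst leaves for Bałaban's split» (`HOME/BINDER-OWNERS.md`; owner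
lineage `b2b-balaban-beta-an4`; this file by co-owner #2 lineage `b2b-balaban-beta-d4-p2`, generation 34), β-FLOW TEAM duty (1),
FREEZE (0) honoured (def-free module in the lineage's `EriceRemainderEnclosure*` series; no new leaf, no new hypothesis shape).  Sequel
of (E30) `EriceRemainderEnclosureHistoryTwoLoop` (p330554; `run_mono` BY NAME) and of node U2's `T4TwoRunUniqueness` (lineage
`t4-ne4-p2`, gen 7; `disc₀_step`, `sum_weights₀_le_of_eventualLower`, `eq_of_disc₀_eq_zero` BY NAME).  Companions: (E32b)
`EriceRemainderEnclosureHistoryUniquenessSharp` (the integer witness: the smallness is load-bearing, the decay is not), (E32c)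
`EriceRemainderEnclosureHistoryUniquenessColumn` (the sign-free column-sum twin; age profiles).

HONEST FRAMING (page 1, verbatim and binding).  *"Discharging BetaPertH makes Bałaban's UV stability UNCONDITIONAL — a real
constructive-QFT result; it is NOT the continuum limit and NOT the Clay problem."*  THIS FILE DISCHARGES NOTHING OF THE KIND.
«UNIQUENESS» here = uniqueness of the tuned BARE COUPLING and of the matched coupling history of the SCALAR recursion (0.20) given the
renormalized coupling at a fixed cutoff, with Lipschitz dependence on it (Hadamard's legs 2–3 of Theorem 2's renormalization
condition, in the sense of `T4TwoRunUniqueness` ∕ `T4TwoRunWellPosed`) — NOT uniqueness of any continuum limit of expectations.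
Every β-side input is a NAMED BINDER on an ABSTRACT family `β : FlowStep.HBeta`, NOT PRINTED and NOT asserted for [I] (1.22): node U2's
`T4CouplingMatching.HistLipschitz Λ γ β` (GAPS G-t4-U2-1∕-2; [I] p. 298 says only that the dependence on the preceding couplings
exists), `EventualLowerH b γ k₀ β` (shape of (0.31)'s lower half), the sign `FlowStep.BetaLowerH 0` or the PRINTED-type two-sided
bound (p. 264 «uniformly bounded», constant unprinted), and — §5 only — row D4's own binders (printed split `B12Beta.OneLoopSplit`,
one-loop tail `2b ≤ β⁰_{k+1}`, junction `Beta.RemainderChain.RemainderConst S γ r`, `r ≤ b`).  Row D4 class UNCHANGED (critical-path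
width 0; instance 0∕1; D4 DISCHARGE NO DATE).  HONEST DEPENDENCY: continuum YM on T⁴ ⇐ BetaPertH ∧ nine spine estimates (0/9
proved); BetaPertH ⇐ (D1) ∧ (D4) ∧ CAP+tail; G-an2-4 gates asym, D1 and NE2/3/4.

THE POINT (census sense (α); the history channel's missing row).  Node U2 proves the uniqueness ∕ pin-Lipschitz leg under
`HistLipschitz Λ γ β` WITH `FadingMemory C θ Λ` (`Λ k i ≤ C·θ^{k−i}`, `θ < 1`) and the smallness `C·U < 1 − θ`, `U = (k₀+1)γ³ + 2γ∕b`
(`T4TwoRunUniqueness.eq_of_pin_eventualLower` ∕ `disc₀_le_of_pins`; `T4TwoRunWellPosed`; `T4BetaFlowWellPosed` with its geometric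
`MemoryProfile`).  The decay enters those proofs at ONE place, the exchange of the double sum `Σ_j Σ_{i≤j} θ^{j−i} u_i δ_i ≤
(1−θ)⁻¹ Σ_i u_i δ_i` (COLUMN sums of the modulus).  Along the runs of (0.20) this is unnecessary: asymptotic freedom ORDERS the
history — under the sign the couplings increase towards the infrared pin ((E30) `run_mono`), under the eventual floor and the
two-sided bound they are NEAR-monotone (`g_i ≤ √2·g_j`, `i ≤ j`, §3) — so the weight `u_i = (g^A_i)² g^B_i` at the INFLUENCING scale
is dominated by the weight at the INFLUENCED scale and the double sum collapses onto the ROWS: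
`Σ_{j<K} Σ_{i≤j} Λ j i·u_i·δ_i ≤ A³·(sup_j Σ_{i≤j} Λ j i)·(Σ_j u_j)·max δ`.  Hence (§2, §4): two runs of length `K` in ]0,γ] with the
same renormalized value COINCIDE, and the matched history in `1∕g²` is Lipschitz in the renormalized `1∕g_K²` with the K-UNIFORM
constant `(1 − A³MU)⁻¹`, under `HistLipschitz Λ γ β` with ONLY the k-uniform ROW TOTAL WEIGHT `Σ_{i≤k} Λ k i ≤ M` — EXACTLY the
junction-sufficient currency of (D4-J2) (`EriceRemainderEnclosureHistoryJunction.osc_le_of_histLipschitz`: osc ≤ M·γ) — and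
`A³·M·U < 1`; no `FadingMemory`, no column bound, no moment, no rate.  Node U2's HYPOTHESIS class is the geometric special case
(`rowSum_of_fadingMemory`: row total weight `M = C∕(1−θ)`); on the row-sum road its smallness `C·U < 1 − θ` (= `M·U < 1`) is
recovered WITH THE SIGN ADDED (`eq_of_pin_fadingMemory_sign`) — node U2's own road sums the COLUMNS `sup_i Σ_{j≥i} Λ j i` and needs no
monotonicity (its sign-free twin is a COLUMN total weight — companion (E32c) `EriceRemainderEnclosureHistoryUniquenessColumn` — NOT the
junction's currency; OWNER's word W-an4-g84-1).  On the D4 column (§5) the floor comes from the JUNCTION: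
`RemainderConst S γ r`, `r ≤ b`, with the one-loop tail `2b ≤ β⁰_{k+1}` (k ≥ k₀) gives `EventualLowerH b γ k₀ β` (OWNER's
`Beta.RemainderChain.betaLowerTail_of_remainderConst` BY NAME), hence `U`, hence uniqueness for `2√2·M·U < 1`: the uniqueness leg
costs the row NOTHING beyond the junction's own currency (row total weight + the floor it buys).  The DECAY of the memory —
consumed by node U2's η-RATE in its typed GEOMETRIC shape `InjectedRate C c θ` (NE4 proper; whether the Cauchy sum's SUMMABILITY needs
it is NOT decided here) and load-bearing for the two-loop VALUE ((E30) first moment; road P3 log-moment) — is idle here; what IS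
load-bearing is the ratio `M·γ∕b` inside `M·U` (node U2's `T4BetaFlowWellPosed` §7 ratio `Cm·γ < b(1−θ)` in
row-sum currency): the companion (E32b) has an integer family with ALL its off-diagonal memory on the bare coupling (bare slot 16 +
Markov slot 32: row total `M = 48`; no fading modulus), floor `b = 1`, sign, and TWO runs in ]0,1] pinned at the same value (`M·U = 144`).
The floor-FREE price (exponential moments of the memory, `T4BetaFlowWellPosed` §9) is a different regime, not touched.

WHAT IS PROVED ([folklore] real analysis over the tree's shapes; 0 `def`, 0 sorry; nothing of [I] asserted).
 §1 `rowSum_fixedPoint` — two-point lemma: `δ_j ≤ δ_{j+1} + Σ_{i≤j} Λ j i·u_i·δ_i`, rows `≤ M`, `u_i ≤ A·u_j` (i ≤ j), `Σ u ≤ U`,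
    `AMU < 1` ⟹ `δ_j ≤ δ_K∕(1 − AMU)`.
 §2 `disc₀_le_of_pins_rowSum` ∕ `eq_of_pin_rowSum` — run level: pin-Lipschitz `(1 − A³MU)⁻¹` and uniqueness for near-monotone runs.
 §3 `nearMono_of_sign` (A = 1; (E30) `run_mono` BY NAME), `nearMono_of_eventualLower` (A = √2: floor + `β ≥ −β′` + `k₀·β′·γ² ≤ 1∕2`).
 §4 ENDs with node U2's K-uniform `U` (`sum_weights₀_le_of_eventualLower` BY NAME): `disc₀_le_of_pins_rowSum_sign` ∕
    **`eq_of_pin_rowSum_sign`** (smallness `M·U < 1`), `disc₀_le_of_pins_rowSum_eventual` ∕ **`eq_of_pin_rowSum_eventual`**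
    (`2√2·M·U < 1`); `rowSum_of_fadingMemory`, `eq_of_pin_fadingMemory_sign` (node U2's binders + sign, node U2's own smallness).
 §5 **`eq_of_pin_of_junction`** ∕ `disc₀_le_of_pins_of_junction` — the row-D4 END: split + one-loop tail + junction (`r ≤ b`) +
    two-sided bound + row-bounded history modulus ⟹ uniqueness and pin-Lipschitz, K-uniform.
-/

noncomputable section

open Finset

namespace Summit.QuantumFields.BalabanUV.Beta.EriceRemainderEnclosureHistoryUniqueness

open Literature.MathematicalPhysics.QuantumFieldTheory.Balaban1983to89
open Literature.MathematicalPhysics.QuantumFieldTheory.Balaban1983to89.FlowStep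
open Literature.MathematicalPhysics.QuantumFieldTheory.Balaban1983to89.T4CouplingMatching
open Literature.MathematicalPhysics.QuantumFieldTheory.Balaban1983to89.T4TwoRunUniqueness
  (disc₀ disc₀_nonneg disc₀_pin eq_of_disc₀_eq_zero disc₀_step sum_weights₀_le_of_eventualLower)
open Literature.MathematicalPhysics.QuantumFieldTheory.Balaban1983to89.Beta.RemainderChain
  (RemainderConst betaLowerTail_of_remainderConst)
open Summit.QuantumFields.BalabanUV.Beta.EriceRemainderEnclosureHistoryTwoLoop (run_mono)

/-! ## §1 The row-sum two-point lemma (pure finite sums) -/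

/-- **ROW-SUM TWO-POINT LEMMA.**  `δ ≥ 0` with `δ_j ≤ δ_{j+1} + Σ_{i≤j} Λ j i·u_i·δ_i` (`j < K`), `Λ ≥ 0` with ROW sums `≤ M`, `u ≥ 0`
NEAR-MONOTONE (`u_i ≤ A·u_j`, `i ≤ j ≤ K`) with `Σ_{j≤K} u_j ≤ U`, and `A·M·U < 1` ⟹ `δ_j ≤ δ_K∕(1 − A·M·U)` for `j ≤ K`: the double sum
collapses onto the rows (`u_i ≤ A u_j`, `δ_i ≤ max δ`); no column bound, no decay in `j − i`. [folklore] -/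
theorem rowSum_fixedPoint {K : ℕ} {δ u : ℕ → ℝ} {Λ : ℕ → ℕ → ℝ} {M A U d : ℝ}
    (hδ : ∀ i, 0 ≤ δ i) (hu : ∀ i, i ≤ K → 0 ≤ u i) (hΛ : ∀ j i, i ≤ j → 0 ≤ Λ j i) (hA : 0 ≤ A) (hM : 0 ≤ M)
    (hrow : ∀ j, j < K → ∑ i ∈ range (j + 1), Λ j i ≤ M)
    (hmono : ∀ i j, i ≤ j → j ≤ K → u i ≤ A * u j)
    (hU : ∑ j ∈ range (K + 1), u j ≤ U) (hsmall : A * M * U < 1) (hK : δ K ≤ d)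
    (hrec : ∀ j, j < K → δ j ≤ δ (j + 1) + ∑ i ∈ range (j + 1), Λ j i * u i * δ i) :
    ∀ j, j ≤ K → δ j ≤ d / (1 - A * M * U) := by
  obtain ⟨i₀, hi₀, hmax⟩ := exists_max_image (range (K + 1)) δ ⟨0, by simp⟩
  set B := δ i₀ with hBdef
  have hB0 : 0 ≤ B := hδ i₀
  have hle : ∀ i, i ≤ K → δ i ≤ B := fun i hi => hmax i (mem_range.mpr (Nat.lt_succ_of_le hi))
  have hstep : ∀ j, j < K → ∑ i ∈ range (j + 1), Λ j i * u i * δ i ≤ A * M * B * u j := by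
    intro j hj
    have h1 : ∀ i ∈ range (j + 1), Λ j i * u i * δ i ≤ Λ j i * (A * u j * B) := by
      intro i hi
      have hij : i ≤ j := Nat.lt_succ_iff.mp (mem_range.mp hi)
      have hiK : i ≤ K := hij.trans hj.le
      rw [mul_assoc]
      exact mul_le_mul_of_nonneg_left
        (mul_le_mul (hmono i j hij hj.le) (hle i hiK) (hδ i) (mul_nonneg hA (hu j hj.le))) (hΛ j i hij)
    calc ∑ i ∈ range (j + 1), Λ j i * u i * δ i ≤ ∑ i ∈ range (j + 1), Λ j i * (A * u j * B) := sum_le_sum h1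
      _ = (∑ i ∈ range (j + 1), Λ j i) * (A * u j * B) := by rw [sum_mul]
      _ ≤ M * (A * u j * B) :=
          mul_le_mul_of_nonneg_right (hrow j hj) (mul_nonneg (mul_nonneg hA (hu j hj.le)) hB0)
      _ = A * M * B * u j := by ring
  have hback := backward_sum (K := K) (δ := fun j => δ j - d) (s := fun j => A * M * B * u j)
    (by show δ K - d ≤ 0; linarith)
    (fun j hj => by
      show δ j - d ≤ (δ (j + 1) - d) + A * M * B * u j
      have h1 := hrec j hj; have h2 := hstep j hj; linarith)
  have hbound : ∀ j, j ≤ K → δ j ≤ d + A * M * U * B := by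
    intro j hj
    have h1 := hback j hj
    have h2 : ∑ i ∈ Ico j K, A * M * B * u i ≤ A * M * B * U := by
      rw [← mul_sum]
      refine mul_le_mul_of_nonneg_left ?_ (mul_nonneg (mul_nonneg hA hM) hB0)
      calc ∑ i ∈ Ico j K, u i ≤ ∑ i ∈ range (K + 1), u i :=
            sum_le_sum_of_subset_of_nonneg
              (fun i hi => mem_range.mpr (by have := (mem_Ico.mp hi).2; omega))
              (fun i hi _ => hu i (Nat.lt_succ_iff.mp (mem_range.mp hi)))
        _ ≤ U := hU
    have h3 : A * M * B * U = A * M * U * B := by ring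
    linarith
  have hBle : B ≤ d + A * M * U * B := hbound i₀ (Nat.lt_succ_iff.mp (mem_range.mp hi₀))
  have hpos : 0 < 1 - A * M * U := by linarith
  have hBfin : B ≤ d / (1 - A * M * U) := by
    rw [le_div_iff₀ hpos]
    have : B * (1 - A * M * U) = B - A * M * U * B := by ring
    linarith
  intro j hj
  exact (hle j hj).trans hBfin

/-! ## §2 Run level: pin-Lipschitz and uniqueness from the ROW total weight along near-monotone runs -/

/-- **PIN-LIPSCHITZ FROM ROW SUMS, K-UNIFORM.**  Two runs of (0.20) of length `K` with the SAME family `β`, couplings in ]0,γ],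
NEAR-MONOTONE (`g_i ≤ A·g_j`, `i ≤ j ≤ K`), under `HistLipschitz Λ γ β` with nonnegative moduli of ROW total weight `Σ_{i≤k} Λ k i ≤ M`
and `Σ_{i≤K} (g^A_i)² g^B_i ≤ U`: if `A³·M·U < 1` then `|1∕(g^A_j)² − 1∕(g^B_j)²| ≤ (1 − A³MU)⁻¹·|1∕(g^A_K)² − 1∕(g^B_K)²|`, `j ≤ K`.  NO fading
memory (`disc₀_step` BY NAME + `abs_sub_le_of_inv_sq` + `rowSum_fixedPoint`); binders only. [cite: Balaban1987RG1, (0.20) p.256 and Thm 2 p.259] -/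
theorem disc₀_le_of_pins_rowSum {β : HBeta} {γ M A U : ℝ} {Λ : ℕ → ℕ → ℝ} {K : ℕ} {gA gB : ℕ → ℝ}
    (hA : RGEqH K β gA) (hB : RGEqH K β gB)
    (hAbox : ∀ i, i ≤ K → 0 < gA i ∧ gA i ≤ γ) (hBbox : ∀ i, i ≤ K → 0 < gB i ∧ gB i ≤ γ)
    (hL : HistLipschitz Λ γ β) (hΛ : ∀ k i, i ≤ k → 0 ≤ Λ k i) (hM : 0 ≤ M)
    (hrow : ∀ k, ∑ i ∈ range (k + 1), Λ k i ≤ M) (hA0 : 0 ≤ A)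
    (hmA : ∀ i j, i ≤ j → j ≤ K → gA i ≤ A * gA j) (hmB : ∀ i j, i ≤ j → j ≤ K → gB i ≤ A * gB j)
    (hU : ∑ i ∈ range (K + 1), (gA i) ^ 2 * gB i ≤ U) (hsmall : A ^ 3 * M * U < 1) :
    ∀ j, j ≤ K → disc₀ gA gB j ≤ disc₀ gA gB K / (1 - A ^ 3 * M * U) := by
  refine rowSum_fixedPoint (δ := disc₀ gA gB) (u := fun i => (gA i) ^ 2 * gB i) (Λ := Λ)
    (disc₀_nonneg gA gB) (fun i hi => mul_nonneg (sq_nonneg _) (hBbox i hi).1.le) hΛ (pow_nonneg hA0 3) hM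
    (fun j _ => hrow j) ?_ hU hsmall le_rfl ?_
  · intro i j hij hjK
    have hgAi := hAbox i (hij.trans hjK)
    have hgBi := hBbox i (hij.trans hjK)
    have hgAj := hAbox j hjK
    have h1 : (gA i) ^ 2 ≤ (A * gA j) ^ 2 := pow_le_pow_left₀ hgAi.1.le (hmA i j hij hjK) 2
    calc (gA i) ^ 2 * gB i ≤ (A * gA j) ^ 2 * (A * gB j) :=
          mul_le_mul h1 (hmB i j hij hjK) hgBi.1.le (by positivity)
      _ = A ^ 3 * ((gA j) ^ 2 * gB j) := by ring
  · intro j hj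
    have hstep := disc₀_step hA hB hAbox hBbox hL hj
    have hsum : ∑ i ∈ range (j + 1), Λ j i * |gA i - gB i|
        ≤ ∑ i ∈ range (j + 1), Λ j i * ((gA i) ^ 2 * gB i) * disc₀ gA gB i := by
      refine sum_le_sum fun i hi => ?_
      have hij : i ≤ j := Nat.lt_succ_iff.mp (mem_range.mp hi)
      have hiK : i ≤ K := by omega
      have hw : |gA i - gB i| ≤ (gA i) ^ 2 * gB i * disc₀ gA gB i :=
        abs_sub_le_of_inv_sq (hAbox i hiK).1 (hBbox i hiK).1
      calc Λ j i * |gA i - gB i| ≤ Λ j i * ((gA i) ^ 2 * gB i * disc₀ gA gB i) :=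
            mul_le_mul_of_nonneg_left hw (hΛ j i hij)
        _ = Λ j i * ((gA i) ^ 2 * gB i) * disc₀ gA gB i := by ring
    linarith

/-- **UNIQUENESS FROM ROW SUMS.**  Under the hypotheses of `disc₀_le_of_pins_rowSum`, two runs with the same renormalized coupling
`g^A_K = g^B_K` coincide at every scale `j ≤ K` — in particular their bare couplings do.  NO fading memory. [cite: Balaban1987RG1, Thm 2 p.259] -/
theorem eq_of_pin_rowSum {β : HBeta} {γ M A U : ℝ} {Λ : ℕ → ℕ → ℝ} {K : ℕ} {gA gB : ℕ → ℝ}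
    (hA : RGEqH K β gA) (hB : RGEqH K β gB)
    (hAbox : ∀ i, i ≤ K → 0 < gA i ∧ gA i ≤ γ) (hBbox : ∀ i, i ≤ K → 0 < gB i ∧ gB i ≤ γ)
    (hL : HistLipschitz Λ γ β) (hΛ : ∀ k i, i ≤ k → 0 ≤ Λ k i) (hM : 0 ≤ M)
    (hrow : ∀ k, ∑ i ∈ range (k + 1), Λ k i ≤ M) (hA0 : 0 ≤ A)
    (hmA : ∀ i j, i ≤ j → j ≤ K → gA i ≤ A * gA j) (hmB : ∀ i j, i ≤ j → j ≤ K → gB i ≤ A * gB j)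
    (hU : ∑ i ∈ range (K + 1), (gA i) ^ 2 * gB i ≤ U) (hsmall : A ^ 3 * M * U < 1) (hpin : gA K = gB K) :
    ∀ j, j ≤ K → gA j = gB j := by
  intro j hj
  have h := disc₀_le_of_pins_rowSum hA hB hAbox hBbox hL hΛ hM hrow hA0 hmA hmB hU hsmall j hj
  rw [disc₀_pin hpin, zero_div] at h
  exact eq_of_disc₀_eq_zero (hAbox j hj).1 (hBbox j hj).1 (le_antisymm h (disc₀_nonneg _ _ _))

/-! ## §3 Sources of near-monotonicity: the sign, or the eventual floor with the two-sided bound -/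

/-- **THE SIGN ORDERS THE RUN** (A = 1): along a run of (0.20) with `β ≥ 0` at every step, `g_i ≤ g_j` for `i ≤ j ≤ K` — (E30)
`EriceRemainderEnclosureHistoryTwoLoop.run_mono` BY NAME. [cite: Balaban1987RG1, (0.20) p.256] -/
theorem nearMono_of_sign {β : HBeta} {K : ℕ} {g : ℕ → ℝ} (h : RGEqH K β g) (hpos : ∀ k, k ≤ K → 0 < g k)
    (hsign : ∀ k, k < K → 0 ≤ β k (prefixOf g k)) : ∀ i j, i ≤ j → j ≤ K → g i ≤ 1 * g j :=
  fun _ _ hij hjK => by rw [one_mul]; exact run_mono h hpos hsign hij hjK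

/-- The sign along a run in the box from the box-level binder `BetaLowerH 0 γ β` (shape of `FlowStep.BetaSignH`). [folklore] -/
theorem sign_along_of_betaLowerH {β : HBeta} {γ : ℝ} {K : ℕ} {g : ℕ → ℝ} (hsign : BetaLowerH 0 γ β)
    (hbox : ∀ k, k ≤ K → 0 < g k ∧ g k ≤ γ) : ∀ k, k < K → 0 ≤ β k (prefixOf g k) :=
  fun k hk => hsign k _ (prefixOf_mem_box hk.le hbox)

/-- **THE EVENTUAL FLOOR NEAR-ORDERS THE RUN** (A = √2): along a run of (0.20) in ]0,γ] with `β ≥ b ≥ 0` on the boxes from scale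
`k₀` on (`EventualLowerH b γ k₀ β`), `β ≥ −β′` on all boxes (lower half of the PRINTED-type bound, p. 264 «uniformly bounded»,
constant unprinted) and `k₀·β′·γ² ≤ 1∕2`: `g_i ≤ √2·g_j` for `i ≤ j ≤ K` (`1∕g_i² ≥ 1∕g_j² − k₀β′ ≥ 1∕(2g_j²)`) — the shape of [III]
(2.6)'s last member «g_m ≦ (1 + β₀)g_n». [cite: Balaban1987RG1, (0.20) p.256 and §1 p.264] -/
theorem nearMono_of_eventualLower {β : HBeta} {γ b β' : ℝ} {k₀ K : ℕ} {g : ℕ → ℝ} (h : RGEqH K β g)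
    (hbox : ∀ k, k ≤ K → 0 < g k ∧ g k ≤ γ) (hb : 0 ≤ b) (hlo : EventualLowerH b γ k₀ β)
    (hβ' : 0 ≤ β') (hlow : ∀ k v, v ∈ Box γ k → -β' ≤ β k v) (hsmall : (k₀ : ℝ) * β' * γ ^ 2 ≤ 1 / 2) :
    ∀ i j, i ≤ j → j ≤ K → g i ≤ Real.sqrt 2 * g j := by
  intro i j hij hjK
  have hgi := hbox i (hij.trans hjK)
  have hgj := hbox j hjK
  have hγ : 0 < γ := hgj.1.trans_le hgj.2
  have htel := inv_sq_telescopeH h hij hjK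
  have hterm : ∀ l ∈ Ico i j, (if l < k₀ then -β' else 0) ≤ β l (prefixOf g l) := by
    intro l hl
    have hlK : l ≤ K := ((mem_Ico.mp hl).2.le.trans hjK)
    have hmem : prefixOf g l ∈ Box γ l := prefixOf_mem_box hlK hbox
    split_ifs with hlk
    · exact hlow l _ hmem
    · exact hb.trans (hlo l _ (not_lt.mp hlk) hmem)
  have hcard : (((Ico i j).filter (· < k₀)).card : ℝ) ≤ k₀ := by
    have : ((Ico i j).filter (· < k₀)).card ≤ (range k₀).card :=
      card_le_card fun l hl => by
        simp only [mem_filter, mem_Ico] at hl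
        exact mem_range.mpr hl.2
    have h' : (((Ico i j).filter (· < k₀)).card : ℝ) ≤ ((range k₀).card : ℝ) := by exact_mod_cast this
    rwa [card_range] at h'
  have hsum : -((k₀ : ℝ) * β') ≤ ∑ l ∈ Ico i j, β l (prefixOf g l) := by
    calc -((k₀ : ℝ) * β') ≤ ∑ l ∈ Ico i j, (if l < k₀ then -β' else 0) := by
          rw [← sum_filter, sum_const, nsmul_eq_mul]
          nlinarith
      _ ≤ _ := sum_le_sum hterm
  have h1 : 1 / γ ^ 2 ≤ 1 / (g j) ^ 2 :=
    one_div_le_one_div_of_le (pow_pos hgj.1 2) (pow_le_pow_left₀ hgj.1.le hgj.2 2)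
  have h2 : (k₀ : ℝ) * β' ≤ 1 / 2 * (1 / γ ^ 2) := by
    rw [show 1 / 2 * (1 / γ ^ 2) = (1 / 2) / γ ^ 2 by ring, le_div_iff₀ (pow_pos hγ 2)]
    exact hsmall
  have h3 : 1 / 2 * (1 / (g j) ^ 2) ≤ 1 / (g i) ^ 2 := by rw [htel]; nlinarith
  have h4 : (g i) ^ 2 ≤ (Real.sqrt 2 * g j) ^ 2 := by
    rw [mul_pow, Real.sq_sqrt (by norm_num : (0 : ℝ) ≤ 2)]; rw [show 1 / 2 * (1 / (g j) ^ 2) = 1 / (2 * (g j) ^ 2) by ring] at h3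
    exact (one_div_le_one_div (mul_pos two_pos (pow_pos hgj.1 2)) (pow_pos hgi.1 2)).mp h3
  exact (pow_le_pow_iff_left₀ hgi.1.le (mul_nonneg (Real.sqrt_nonneg 2) hgj.1.le) two_ne_zero).mp h4

/-! ## §4 ENDs with node U2's K-uniform asymptotic-freedom weight sum `U = (k₀+1)γ³ + 2γ∕b` -/

/-- **PIN-LIPSCHITZ, SIGN FORM.**  Two runs of (0.20) of length `K` in ]0,γ], same family, under `HistLipschitz Λ γ β` with row total
weight `M`, the sign `BetaLowerH 0 γ β` and the eventual floor `EventualLowerH b γ k₀ β` (`b > 0`): if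
`M·((k₀+1)γ³ + 2γ∕b) < 1` then `|1∕(g^A_j)² − 1∕(g^B_j)²| ≤ (1 − M((k₀+1)γ³ + 2γ∕b))⁻¹ · |1∕(g^A_K)² − 1∕(g^B_K)²|`, `j ≤ K`, K-uniform.
NO fading memory (compare `T4TwoRunUniqueness.disc₀_le_of_pins`: `FadingMemory C θ Λ`, `C·U < 1−θ`); binders only. [cite: Balaban1987RG1, (0.20) p.256, Thm 2 p.259, (0.31) p.259] -/
theorem disc₀_le_of_pins_rowSum_sign {β : HBeta} {γ b M : ℝ} {k₀ : ℕ} {Λ : ℕ → ℕ → ℝ} {K : ℕ} {gA gB : ℕ → ℝ}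
    (hb : 0 < b) (hA : RGEqH K β gA) (hB : RGEqH K β gB)
    (hAbox : ∀ i, i ≤ K → 0 < gA i ∧ gA i ≤ γ) (hBbox : ∀ i, i ≤ K → 0 < gB i ∧ gB i ≤ γ)
    (hL : HistLipschitz Λ γ β) (hΛ : ∀ k i, i ≤ k → 0 ≤ Λ k i) (hM : 0 ≤ M)
    (hrow : ∀ k, ∑ i ∈ range (k + 1), Λ k i ≤ M) (hsign : BetaLowerH 0 γ β) (hlo : EventualLowerH b γ k₀ β)
    (hsmall : M * (((k₀ : ℝ) + 1) * γ ^ 3 + 2 * γ / b) < 1) :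
    ∀ j, j ≤ K → disc₀ gA gB j ≤ disc₀ gA gB K / (1 - M * (((k₀ : ℝ) + 1) * γ ^ 3 + 2 * γ / b)) := by
  have hγ : 0 < γ := (hAbox 0 (Nat.zero_le _)).1.trans_le (hAbox 0 (Nat.zero_le _)).2
  have hU := sum_weights₀_le_of_eventualLower hγ hb hA hB hAbox hBbox hlo
  have hmA := nearMono_of_sign hA (fun k hk => (hAbox k hk).1) (sign_along_of_betaLowerH hsign hAbox)
  have hmB := nearMono_of_sign hB (fun k hk => (hBbox k hk).1) (sign_along_of_betaLowerH hsign hBbox)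
  have h := disc₀_le_of_pins_rowSum hA hB hAbox hBbox hL hΛ hM hrow zero_le_one hmA hmB hU
    (by simpa only [one_pow, one_mul] using hsmall)
  simp only [one_pow, one_mul] at h
  exact h

/-- **UNIQUENESS OF THE TUNED BARE COUPLING, SIGN FORM — NO FADING MEMORY.**  Under the binders of `disc₀_le_of_pins_rowSum_sign`,
two runs with `g^A_K = g^B_K` coincide at every scale, uniformly in `K`; the memory enters through ONE number, the row total weight `M`
((D4-J2)'s junction currency). [cite: Balaban1987RG1, Thm 2 p.259] -/
theorem eq_of_pin_rowSum_sign {β : HBeta} {γ b M : ℝ} {k₀ : ℕ} {Λ : ℕ → ℕ → ℝ} {K : ℕ} {gA gB : ℕ → ℝ}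
    (hb : 0 < b) (hA : RGEqH K β gA) (hB : RGEqH K β gB)
    (hAbox : ∀ i, i ≤ K → 0 < gA i ∧ gA i ≤ γ) (hBbox : ∀ i, i ≤ K → 0 < gB i ∧ gB i ≤ γ)
    (hL : HistLipschitz Λ γ β) (hΛ : ∀ k i, i ≤ k → 0 ≤ Λ k i) (hM : 0 ≤ M)
    (hrow : ∀ k, ∑ i ∈ range (k + 1), Λ k i ≤ M) (hsign : BetaLowerH 0 γ β) (hlo : EventualLowerH b γ k₀ β)
    (hsmall : M * (((k₀ : ℝ) + 1) * γ ^ 3 + 2 * γ / b) < 1) (hpin : gA K = gB K) :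
    ∀ j, j ≤ K → gA j = gB j := by
  intro j hj
  have h := disc₀_le_of_pins_rowSum_sign hb hA hB hAbox hBbox hL hΛ hM hrow hsign hlo hsmall j hj
  rw [disc₀_pin hpin, zero_div] at h
  exact eq_of_disc₀_eq_zero (hAbox j hj).1 (hBbox j hj).1 (le_antisymm h (disc₀_nonneg _ _ _))

/-- **PIN-LIPSCHITZ, EVENTUAL FORM** (no sign before `k₀`): two runs of (0.20) of length `K` in ]0,γ], same family, `HistLipschitz Λ γ β`
with row total weight `M`, `EventualLowerH b γ k₀ β` (`b > 0`), `β ≥ −β′` on the boxes (lower half of the PRINTED-type bound),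
`k₀·β′·γ² ≤ 1∕2`, `2√2·M·((k₀+1)γ³ + 2γ∕b) < 1` ⟹ pin-Lipschitz with the K-uniform constant `(1 − 2√2·M((k₀+1)γ³ + 2γ∕b))⁻¹`.  NO fading
memory. [cite: Balaban1987RG1, (0.20) p.256, Thm 2 p.259, §1 p.264] -/
theorem disc₀_le_of_pins_rowSum_eventual {β : HBeta} {γ b β' M : ℝ} {k₀ : ℕ} {Λ : ℕ → ℕ → ℝ} {K : ℕ} {gA gB : ℕ → ℝ}
    (hb : 0 < b) (hA : RGEqH K β gA) (hB : RGEqH K β gB)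
    (hAbox : ∀ i, i ≤ K → 0 < gA i ∧ gA i ≤ γ) (hBbox : ∀ i, i ≤ K → 0 < gB i ∧ gB i ≤ γ)
    (hL : HistLipschitz Λ γ β) (hΛ : ∀ k i, i ≤ k → 0 ≤ Λ k i) (hM : 0 ≤ M)
    (hrow : ∀ k, ∑ i ∈ range (k + 1), Λ k i ≤ M) (hlo : EventualLowerH b γ k₀ β)
    (hβ' : 0 ≤ β') (hlow : ∀ k v, v ∈ Box γ k → -β' ≤ β k v) (hk₀ : (k₀ : ℝ) * β' * γ ^ 2 ≤ 1 / 2)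
    (hsmall : 2 * Real.sqrt 2 * M * (((k₀ : ℝ) + 1) * γ ^ 3 + 2 * γ / b) < 1) :
    ∀ j, j ≤ K → disc₀ gA gB j ≤
      disc₀ gA gB K / (1 - 2 * Real.sqrt 2 * M * (((k₀ : ℝ) + 1) * γ ^ 3 + 2 * γ / b)) := by
  have hγ : 0 < γ := (hAbox 0 (Nat.zero_le _)).1.trans_le (hAbox 0 (Nat.zero_le _)).2
  have hU := sum_weights₀_le_of_eventualLower hγ hb hA hB hAbox hBbox hlo
  have hmA := nearMono_of_eventualLower hA hAbox hb.le hlo hβ' hlow hk₀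
  have hmB := nearMono_of_eventualLower hB hBbox hb.le hlo hβ' hlow hk₀
  have e : Real.sqrt 2 ^ 3 = 2 * Real.sqrt 2 := by rw [pow_succ, Real.sq_sqrt (by norm_num : (0 : ℝ) ≤ 2)]
  have h := disc₀_le_of_pins_rowSum hA hB hAbox hBbox hL hΛ hM hrow (Real.sqrt_nonneg 2) hmA hmB hU
    (by rw [e]; exact hsmall)
  simpa only [e] using h

/-- **UNIQUENESS OF THE TUNED BARE COUPLING, EVENTUAL FORM — NO FADING MEMORY.**  Under the binders of `disc₀_le_of_pins_rowSum_eventual`,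
two runs with `g^A_K = g^B_K` coincide at every scale, uniformly in `K`. [cite: Balaban1987RG1, Thm 2 p.259] -/
theorem eq_of_pin_rowSum_eventual {β : HBeta} {γ b β' M : ℝ} {k₀ : ℕ} {Λ : ℕ → ℕ → ℝ} {K : ℕ} {gA gB : ℕ → ℝ}
    (hb : 0 < b) (hA : RGEqH K β gA) (hB : RGEqH K β gB)
    (hAbox : ∀ i, i ≤ K → 0 < gA i ∧ gA i ≤ γ) (hBbox : ∀ i, i ≤ K → 0 < gB i ∧ gB i ≤ γ)
    (hL : HistLipschitz Λ γ β) (hΛ : ∀ k i, i ≤ k → 0 ≤ Λ k i) (hM : 0 ≤ M)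
    (hrow : ∀ k, ∑ i ∈ range (k + 1), Λ k i ≤ M) (hlo : EventualLowerH b γ k₀ β)
    (hβ' : 0 ≤ β') (hlow : ∀ k v, v ∈ Box γ k → -β' ≤ β k v) (hk₀ : (k₀ : ℝ) * β' * γ ^ 2 ≤ 1 / 2)
    (hsmall : 2 * Real.sqrt 2 * M * (((k₀ : ℝ) + 1) * γ ^ 3 + 2 * γ / b) < 1) (hpin : gA K = gB K) :
    ∀ j, j ≤ K → gA j = gB j := by
  intro j hj
  have h := disc₀_le_of_pins_rowSum_eventual hb hA hB hAbox hBbox hL hΛ hM hrow hlo hβ' hlow hk₀ hsmall j hj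
  rw [disc₀_pin hpin, zero_div] at h
  exact eq_of_disc₀_eq_zero (hAbox j hj).1 (hBbox j hj).1 (le_antisymm h (disc₀_nonneg _ _ _))

/-- **NODE U2's CLASS IS THE GEOMETRIC SPECIAL CASE**: `FadingMemory C θ Λ` (`0 ≤ θ < 1`) gives nonnegative moduli with ROW
total weight `Σ_{i≤k} Λ k i ≤ C∕(1 − θ)` at every scale. [folklore] -/
theorem rowSum_of_fadingMemory {C θ : ℝ} {Λ : ℕ → ℕ → ℝ} (hθ0 : 0 ≤ θ) (hθ1 : θ < 1) (hΛ : FadingMemory C θ Λ)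
    (k : ℕ) : ∑ i ∈ range (k + 1), Λ k i ≤ C / (1 - θ) := by
  have hC : 0 ≤ C := by have h := (hΛ 0 0 le_rfl); simpa using h.1.trans h.2
  calc ∑ i ∈ range (k + 1), Λ k i ≤ ∑ i ∈ range (k + 1), C * θ ^ (k - i) :=
        sum_le_sum fun i hi => (hΛ k i (Nat.lt_succ_iff.mp (mem_range.mp hi))).2
    _ = C * ∑ i ∈ range (k + 1), θ ^ (k + 1 - 1 - i) := by
        rw [mul_sum]; exact sum_congr rfl fun i _ => by rw [show k + 1 - 1 - i = k - i by omega]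
    _ = C * ∑ m ∈ range (k + 1), θ ^ m := by rw [sum_range_reflect (fun m => θ ^ m) (k + 1)]
    _ ≤ C * (1 / (1 - θ)) := by
        refine mul_le_mul_of_nonneg_left ?_ hC
        rw [le_div_iff₀ (by linarith : 0 < 1 - θ), geom_sum_mul_neg]; linarith [pow_nonneg hθ0 (k + 1)]
    _ = C / (1 - θ) := by ring

/-- CONSISTENCY WITH NODE U2 (`T4TwoRunUniqueness.eq_of_pin_eventualLower`): its binder list — `FadingMemory C θ Λ`, `0 ≤ θ < 1`,
`EventualLowerH b γ k₀ β`, `C·((k₀+1)γ³ + 2γ∕b) < 1 − θ` — with the sign added, fed through the row-sum road: the fading memory is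
consumed ONLY through its row total weight `C∕(1−θ)`, and node U2's smallness IS `M·U < 1` for that `M`. [cite: Balaban1987RG1, Thm 2 p.259] -/
theorem eq_of_pin_fadingMemory_sign {β : HBeta} {γ b C θ : ℝ} {k₀ : ℕ} {Λ : ℕ → ℕ → ℝ} {K : ℕ} {gA gB : ℕ → ℝ}
    (hb : 0 < b) (hθ0 : 0 ≤ θ) (hθ1 : θ < 1)
    (hsmall : C * (((k₀ : ℝ) + 1) * γ ^ 3 + 2 * γ / b) < 1 - θ)
    (hA : RGEqH K β gA) (hB : RGEqH K β gB)
    (hAbox : ∀ i, i ≤ K → 0 < gA i ∧ gA i ≤ γ) (hBbox : ∀ i, i ≤ K → 0 < gB i ∧ gB i ≤ γ)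
    (hpin : gA K = gB K) (hL : HistLipschitz Λ γ β) (hΛ : FadingMemory C θ Λ) (hsign : BetaLowerH 0 γ β)
    (hlo : EventualLowerH b γ k₀ β) : ∀ j, j ≤ K → gA j = gB j := by
  have hC : 0 ≤ C := by have h := (hΛ 0 0 le_rfl); simpa using h.1.trans h.2
  have hM : 0 ≤ C / (1 - θ) := div_nonneg hC (by linarith)
  refine eq_of_pin_rowSum_sign hb hA hB hAbox hBbox hL (fun k i hik => (hΛ k i hik).1) hM
    (rowSum_of_fadingMemory hθ0 hθ1 hΛ) hsign hlo ?_ hpin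
  rw [div_mul_eq_mul_div, div_lt_iff₀ (by linarith : (0 : ℝ) < 1 - θ), one_mul]
  exact hsmall

/-! ## §5 The row-D4 END: the junction buys the floor, the floor makes the uniqueness leg row-summable -/

/-- **THE JUNCTION PAYS THE UNIQUENESS LEG (pin-Lipschitz form).**  Row D4's junction binders — the PRINTED split `S` ([I]
(2.12)–(2.14)), a one-loop tail `2b ≤ β⁰_{k+1}` (`k ≥ k₀`), `RemainderConst S γ r` with `r ≤ b` (binder (D4) itself, NOT discharged) —
give the floor `b` from `k₀` on (OWNER's `Beta.RemainderChain.betaLowerTail_of_remainderConst` BY NAME); with `β ≥ −β′` on the boxes,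
`k₀·β′·γ² ≤ 1∕2` and a history modulus of ROW total weight `M`, `2√2·M·((k₀+1)γ³ + 2γ∕b) < 1`, two runs of (0.20) of length `K` in
]0,γ] are pin-Lipschitz in `1∕g²` with the K-uniform constant `(1 − 2√2·M((k₀+1)γ³ + 2γ∕b))⁻¹`.  NO decay of the memory.  Nothing of
[I] (1.22) asserted. [cite: Balaban1987RG1, (2.12)–(2.14) p.268 and Thm 2 p.259] -/
theorem disc₀_le_of_pins_of_junction {β : HBeta} (S : B12Beta.OneLoopSplit β) {γ b r β' M : ℝ} {k₀ K : ℕ}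
    {Λ : ℕ → ℕ → ℝ} {gA gB : ℕ → ℝ}
    (hb : 0 < b) (hAF0 : ∀ k, k₀ ≤ k → 2 * b ≤ S.β0 k) (hrem : RemainderConst S γ r) (hr : r ≤ b)
    (hβ' : 0 ≤ β') (hlow : ∀ k v, v ∈ Box γ k → -β' ≤ β k v) (hk₀ : (k₀ : ℝ) * β' * γ ^ 2 ≤ 1 / 2)
    (hL : HistLipschitz Λ γ β) (hΛ : ∀ k i, i ≤ k → 0 ≤ Λ k i) (hM : 0 ≤ M)
    (hrow : ∀ k, ∑ i ∈ range (k + 1), Λ k i ≤ M)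
    (hsmall : 2 * Real.sqrt 2 * M * (((k₀ : ℝ) + 1) * γ ^ 3 + 2 * γ / b) < 1)
    (hA : RGEqH K β gA) (hB : RGEqH K β gB)
    (hAbox : ∀ i, i ≤ K → 0 < gA i ∧ gA i ≤ γ) (hBbox : ∀ i, i ≤ K → 0 < gB i ∧ gB i ≤ γ) :
    ∀ j, j ≤ K → disc₀ gA gB j ≤
      disc₀ gA gB K / (1 - 2 * Real.sqrt 2 * M * (((k₀ : ℝ) + 1) * γ ^ 3 + 2 * γ / b)) :=
  have hlo : EventualLowerH b γ k₀ β := fun k v hk hv => betaLowerTail_of_remainderConst S hAF0 hrem hr k hk v hv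
  disc₀_le_of_pins_rowSum_eventual hb hA hB hAbox hBbox hL hΛ hM hrow hlo hβ' hlow hk₀ hsmall

/-- **THE JUNCTION PAYS THE UNIQUENESS LEG — THE ROW-D4 END.**  Under the binders of `disc₀_le_of_pins_of_junction`, two runs of
(0.20) of length `K` in ]0,γ] pinned at `g^A_K = g^B_K` COINCIDE at every scale — the tuned bare coupling `g₀(ε, g)` of Theorem 2 is
unique — uniformly in `K`, the history modulus entering ONLY through its row total weight `M` ((D4-J2)'s junction currency) and the
floor `b` the junction buys; NO `FadingMemory`, no column bound, no moment, no rate (compare `T4TwoRunUniqueness.eq_of_pin_eventualLower`).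
Binders, never facts; row D4 class UNCHANGED. [cite: Balaban1987RG1, Thm 2 p.259 and (2.12)–(2.14) p.268] -/
theorem eq_of_pin_of_junction {β : HBeta} (S : B12Beta.OneLoopSplit β) {γ b r β' M : ℝ} {k₀ K : ℕ}
    {Λ : ℕ → ℕ → ℝ} {gA gB : ℕ → ℝ}
    (hb : 0 < b) (hAF0 : ∀ k, k₀ ≤ k → 2 * b ≤ S.β0 k) (hrem : RemainderConst S γ r) (hr : r ≤ b)
    (hβ' : 0 ≤ β') (hlow : ∀ k v, v ∈ Box γ k → -β' ≤ β k v) (hk₀ : (k₀ : ℝ) * β' * γ ^ 2 ≤ 1 / 2)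
    (hL : HistLipschitz Λ γ β) (hΛ : ∀ k i, i ≤ k → 0 ≤ Λ k i) (hM : 0 ≤ M)
    (hrow : ∀ k, ∑ i ∈ range (k + 1), Λ k i ≤ M)
    (hsmall : 2 * Real.sqrt 2 * M * (((k₀ : ℝ) + 1) * γ ^ 3 + 2 * γ / b) < 1)
    (hA : RGEqH K β gA) (hB : RGEqH K β gB)
    (hAbox : ∀ i, i ≤ K → 0 < gA i ∧ gA i ≤ γ) (hBbox : ∀ i, i ≤ K → 0 < gB i ∧ gB i ≤ γ) (hpin : gA K = gB K) :
    ∀ j, j ≤ K → gA j = gB j :=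
  have hlo : EventualLowerH b γ k₀ β := fun k v hk hv => betaLowerTail_of_remainderConst S hAF0 hrem hr k hk v hv
  eq_of_pin_rowSum_eventual hb hA hB hAbox hBbox hL hΛ hM hrow hlo hβ' hlow hk₀ hsmall hpin

end Summit.QuantumFields.BalabanUV.Beta.EriceRemainderEnclosureHistoryUniqueness

end
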